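import Literature.AlgebraicGeometry.Motives.ProductAffineChart
import Mathlib.RingTheory.IsTensorProduct
import HarnessLib

/-!
# The product affine charts `pr₁⁻¹U ∩ pr₂⁻¹V` cover `Y ×_K Z`, are affine, and have section ring
# `Γ(U) ⊗_K Γ(V)` (a pushout square of rings)

For `K`-schemes `Y, Z` (objects of `Over (Spec K)`, any commutative ring `K`; the product `Y ⊗ Z` is
Mathlib's fibre product with projections `fst Y Z`, `snd Y Z`) and AFFINE opens `U ⊆ Y`, `V ⊆ Z`,
the open `W(U, V) = pr₁⁻¹U ∩ pr₂⁻¹V ⊆ Y ×_K Z` is the image of the product chart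
`Spec (Γ(U) ⊗_K Γ(V)) → Y ×_K Z` of `Motives/ProductAffineChart.exists_productChart` (Hartshorne II
Thm. 3.3, Steps 1–3: «for `X, Y` affine, `Spec (A ⊗ B)` is a product»; «products are local on the
factors»). This file records the three facts about these opens that a sections-level argument on
`Y ×_K Z` consumes (cell `pub-hodge-ring2`, crux stmt-HodgeConjecture-26512, the product formula for
`Ω¹`, step F2c of the BLR route to `stub_cotangentSheafFree`):

* `isAffineOpen_fst_inf_snd` — `pr₁⁻¹U ∩ pr₂⁻¹V` is an affine open;
* `exists_ringEquiv_sections_fst_inf_snd` — **`Γ(U) ⊗_K Γ(V) ≃+* Γ(Y ×_K Z, pr₁⁻¹U ∩ pr₂⁻¹V)` with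
  `a ⊗ 1 ↦ pr₁♯ a` and `1 ⊗ b ↦ pr₂♯ b`** (the restriction maps `Scheme.Hom.appLE`);
* `isPushout_sections_fst_inf_snd` — hence, for ANY algebra structures on `Γ(W)` over `Γ(U)`, `Γ(V)`, `K`
  whose structure maps are `pr₁♯`, `pr₂♯` (and compatible with `K`), the square
  `K → Γ(U), Γ(V) → Γ(W)` is a pushout: `Algebra.IsPushout K Γ(U) Γ(V) Γ(W)` (Mathlib
  `Algebra.IsPushout.of_equiv` from `TensorProduct.isPushout`);
* `iSup_fst_inf_snd_eq_top` — the opens `W(U, V)`, `U, V` affine, cover `Y ×_K Z`.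

The `K`-algebra structures on `Γ(U)`, `Γ(V)` are instance binders with the hypotheses `h₁`, `h₂` that
they are the structure maps `K = Γ(Spec K) → Γ(Y, ⊤) → Γ(Y, U)` (the convention of
`exists_productChart`). Everything is proved; no definitions, no named facts.

presearch: «fibre product of affine schemes is Spec of the tensor product; products are local» →
[Hartshorne1977 II Thm. 3.3] (tree `exists_productChart` = the chart itself); this file adds only the
section-ring identification and the cover (rg `IsPushout.*appLE`, `iSup.*fst.*snd` in Literature: 0
hits); Mathlib: `pullbackSpecIso`, `Scheme.Pullback.openCoverOfLeftRight` (cover of a pullback by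
pullbacks of opens — not in the `Γ`/`IsPushout` form needed); corpus+galaxy not queried (textbook).

## References

* R. Hartshorne, *Algebraic Geometry*, GTM 52 (1977), II Thm. 3.3 (Steps 1–3). [Hartshorne1977]
* U. Görtz, T. Wedhorn, *Algebraic Geometry I*, 2nd ed. (2020), Prop. 4.20, Cor. 4.19 (products of
  affine schemes; `Γ` of an open affine). [GortzWedhorn2020]
-/

noncomputable section

open CategoryTheory CategoryTheory.Limits MonoidalCategory CartesianMonoidalCategory AlgebraicGeometry
open TopologicalSpace Opposite TensorProduct

universe u

namespace Literature.AlgebraicGeometry.Motives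

variable {K : Type u} [CommRing K] (Y Z : Over (Spec (CommRingCat.of K)))

/-! ### The open `pr₁⁻¹U ∩ pr₂⁻¹V` -/

section Cover

/-- **The product charts cover `Y ×_K Z`**: every point lies in `pr₁⁻¹U ∩ pr₂⁻¹V` for some affine opens
`U ∋ pr₁ p`, `V ∋ pr₂ p` (affine opens form a basis). [cite: Hartshorne1977, II Thm. 3.3 (Step 3)] -/
theorem iSup_fst_inf_snd_eq_top :
    ⨆ i : Y.left.affineOpens × Z.left.affineOpens,
      ((fst Y Z).left ⁻¹ᵁ (i.1 : Y.left.Opens) ⊓ (snd Y Z).left ⁻¹ᵁ (i.2 : Z.left.Opens)) = ⊤ := by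
  refine top_le_iff.mp fun p _ => ?_
  obtain ⟨U, hU, hpU, -⟩ := exists_isAffineOpen_mem_and_subset (X := Y.left)
    (x := (fst Y Z).left.base p) (U := ⊤) (Set.mem_univ _)
  obtain ⟨V, hV, hpV, -⟩ := exists_isAffineOpen_mem_and_subset (X := Z.left)
    (x := (snd Y Z).left.base p) (U := ⊤) (Set.mem_univ _)
  exact Opens.mem_iSup.mpr ⟨⟨⟨U, hU⟩, ⟨V, hV⟩⟩, ⟨hpU, hpV⟩⟩

end Cover

section Chart

variable {U : Y.left.Opens} (hU : IsAffineOpen U) {V : Z.left.Opens} (hV : IsAffineOpen V)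
  [Algebra K Γ(Y.left, U)] [Algebra K Γ(Z.left, V)]
  (h₁ : algebraMap K Γ(Y.left, U) = ((Scheme.ΓSpecIso (.of K)).inv ≫ Y.hom.appLE ⊤ U le_top).hom)
  (h₂ : algebraMap K Γ(Z.left, V) = ((Scheme.ΓSpecIso (.of K)).inv ≫ Z.hom.appLE ⊤ V le_top).hom)

/-- `appLE` along equal morphisms. [folklore] -/
private theorem appLE_congr_hom {X₁ X₂ : Scheme.{u}} {f g : X₁ ⟶ X₂} (h : f = g) (U₂ : X₂.Opens)
    (U₁ : X₁.Opens) (e : U₁ ≤ f ⁻¹ᵁ U₂) : f.appLE U₂ U₁ e = g.appLE U₂ U₁ (h ▸ e) := by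
  subst h; rfl

/-- For an affine open `U`, the chart `Spec Γ(U) → X` pulls sections over `U` back to global sections
by `Γ(U) ≅ Γ(Spec Γ(U), ⊤)` (Mathlib `IsAffineOpen.fromSpec_app_self`; `Γ(Spec A, 𝒪) = A`). [cite: Hartshorne1977, II Prop. 2.2 (c)] -/
theorem fromSpec_appLE_top {X : Scheme.{u}} {U : X.Opens} (hU : IsAffineOpen U)
    (e : (⊤ : (Spec Γ(X, U)).Opens) ≤ hU.fromSpec ⁻¹ᵁ U) :
    hU.fromSpec.appLE U ⊤ e = (Scheme.ΓSpecIso Γ(X, U)).inv := by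
  rw [Scheme.Hom.appLE, hU.fromSpec_app_self, Category.assoc, ← Functor.map_comp]
  have hid : ((eqToHom hU.fromSpec_preimage_self).op ≫ (homOfLE e).op :
      op (⊤ : (Spec Γ(X, U)).Opens) ⟶ op ⊤) = 𝟙 _ := Subsingleton.elim _ _
  rw [hid, CategoryTheory.Functor.map_id, Category.comp_id]

/-- `Spec φ` on global sections is `φ`, through `Γ(Spec R, ⊤) ≅ R` (Mathlib `ΓSpecIso_inv_naturality`).
[folklore] -/
private theorem ΓSpecIso_inv_appTop_hom {R S : CommRingCat.{u}} (φ : R ⟶ S) :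
    (Scheme.ΓSpecIso R).inv ≫ (Spec.map φ).appLE ⊤ ⊤ le_top ≫ (Scheme.ΓSpecIso S).hom = φ := by
  have h : (Spec.map φ).appLE ⊤ ⊤ le_top = (Spec.map φ).appTop := by
    rw [Scheme.Hom.appTop, Scheme.Hom.app_eq_appLE]
    rfl
  rw [h, ← Category.assoc, ← Scheme.ΓSpecIso_inv_naturality, Category.assoc, Iso.inv_hom_id,
    Category.comp_id]

include hU hV h₁ h₂ in
/-- **The product chart in ring form**: there is an open immersion `c : Spec (Γ(U) ⊗_K Γ(V)) → Y ×_K Z`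
with image `pr₁⁻¹U ∩ pr₂⁻¹V` such that pulling back sections along `c` (an isomorphism
`Γ(Y ×_K Z, pr₁⁻¹U ∩ pr₂⁻¹V) ≅ Γ(U) ⊗_K Γ(V)`) sends `pr₁♯ a` to `a ⊗ 1` and `pr₂♯ b` to `1 ⊗ b`.
[cite: Hartshorne1977, II Thm. 3.3 (Steps 1–3)] -/
theorem exists_iso_sections_fst_inf_snd :
    ∃ ρ : Γ((Y ⊗ Z).left, (fst Y Z).left ⁻¹ᵁ U ⊓ (snd Y Z).left ⁻¹ᵁ V) ≅
        CommRingCat.of (Γ(Y.left, U) ⊗[K] Γ(Z.left, V)),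
      (fst Y Z).left.appLE U _ inf_le_left ≫ ρ.hom =
          CommRingCat.ofHom Algebra.TensorProduct.includeLeftRingHom ∧
      (snd Y Z).left.appLE V _ inf_le_right ≫ ρ.hom =
          CommRingCat.ofHom (Algebra.TensorProduct.includeRight (R := K)
            (A := Γ(Y.left, U)) (B := Γ(Z.left, V))).toRingHom := by
  obtain ⟨c, hc, hrange, hc₁, hc₂⟩ := exists_productChart Y Z hU hV h₁ h₂
  set W : (Y ⊗ Z).left.Opens := (fst Y Z).left ⁻¹ᵁ U ⊓ (snd Y Z).left ⁻¹ᵁ V with hWdef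
  -- the image of the chart is `W`
  have hW : c ''ᵁ ⊤ = W := by
    rw [Scheme.Hom.image_top_eq_opensRange]
    ext1
    rw [Scheme.Hom.coe_opensRange, hrange]
    rfl
  let ρ : Γ((Y ⊗ Z).left, W) ≅ CommRingCat.of (Γ(Y.left, U) ⊗[K] Γ(Z.left, V)) :=
    (Y ⊗ Z).left.presheaf.mapIso (eqToIso hW).op ≪≫ c.appIso ⊤ ≪≫ Scheme.ΓSpecIso _
  -- the key computation, for either projection
  have key : ∀ {X : Scheme.{u}} (pr : (Y ⊗ Z).left ⟶ X) {O : X.Opens} (hO : IsAffineOpen O)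
      (hWO : W ≤ pr ⁻¹ᵁ O) (φ : Γ(X, O) ⟶ CommRingCat.of (Γ(Y.left, U) ⊗[K] Γ(Z.left, V)))
      (hcpr : c ≫ pr = Spec.map φ ≫ hO.fromSpec), pr.appLE O W hWO ≫ ρ.hom = φ := by
    intro X pr O hO hWO φ hcpr
    change pr.appLE O W hWO ≫ ((Y ⊗ Z).left.presheaf.map (eqToHom hW).op ≫ (c.appIso ⊤).hom ≫
      (Scheme.ΓSpecIso _).hom) = φ
    rw [Scheme.Hom.appIso_hom', Scheme.Hom.appLE_map_assoc, Scheme.Hom.appLE_comp_appLE_assoc,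
      appLE_congr_hom hcpr,
      ← Scheme.Hom.appLE_comp_appLE_assoc _ _ O ⊤ ⊤ hO.fromSpec_preimage_self.ge le_top,
      fromSpec_appLE_top, ΓSpecIso_inv_appTop_hom]
  refine ⟨ρ, key (fst Y Z).left hU inf_le_left _ hc₁, key (snd Y Z).left hV inf_le_right _ hc₂⟩

include hU hV h₁ h₂ in
/-- **`pr₁⁻¹U ∩ pr₂⁻¹V` is an affine open of `Y ×_K Z`** (the image of the open immersion
`Spec (Γ(U) ⊗_K Γ(V)) → Y ×_K Z`). [cite: Hartshorne1977, II Thm. 3.3 (Step 3)] -/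
theorem isAffineOpen_fst_inf_snd :
    IsAffineOpen ((fst Y Z).left ⁻¹ᵁ U ⊓ (snd Y Z).left ⁻¹ᵁ V) := by
  obtain ⟨c, hc, hrange, -, -⟩ := exists_productChart Y Z hU hV h₁ h₂
  have hW : c.opensRange = (fst Y Z).left ⁻¹ᵁ U ⊓ (snd Y Z).left ⁻¹ᵁ V := by
    ext1
    rw [Scheme.Hom.coe_opensRange, hrange]
    rfl
  rw [← hW]
  exact isAffineOpen_opensRange c

include hU hV h₁ h₂ in
/-- **`Γ(U) ⊗_K Γ(V) ≃ Γ(Y ×_K Z, pr₁⁻¹U ∩ pr₂⁻¹V)`, `a ⊗ 1 ↦ pr₁♯ a`, `1 ⊗ b ↦ pr₂♯ b`** (ring form of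
the product chart, Hartshorne II Thm. 3.3: `U ×_K V = Spec (Γ(U) ⊗_K Γ(V))`). [cite: Hartshorne1977, II Thm. 3.3] -/
theorem exists_ringEquiv_sections_fst_inf_snd :
    ∃ r : Γ(Y.left, U) ⊗[K] Γ(Z.left, V) ≃+*
        Γ((Y ⊗ Z).left, (fst Y Z).left ⁻¹ᵁ U ⊓ (snd Y Z).left ⁻¹ᵁ V),
      (∀ a, r (a ⊗ₜ 1) = (fst Y Z).left.appLE U _ inf_le_left a) ∧
      (∀ b, r (1 ⊗ₜ b) = (snd Y Z).left.appLE V _ inf_le_right b) := by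
  obtain ⟨ρ, hρ₁, hρ₂⟩ := exists_iso_sections_fst_inf_snd Y Z hU hV h₁ h₂
  refine ⟨ρ.commRingCatIsoToRingEquiv.symm, fun a => ?_, fun b => ?_⟩
  · apply ρ.commRingCatIsoToRingEquiv.injective
    rw [RingEquiv.apply_symm_apply]
    change _ = (_ ≫ ρ.hom) a
    rw [hρ₁]
    rfl
  · apply ρ.commRingCatIsoToRingEquiv.injective
    rw [RingEquiv.apply_symm_apply]
    change _ = (_ ≫ ρ.hom) b
    simp only [hρ₂]
    rfl

include hU hV h₁ h₂ in
/-- **The section rings of the product chart form a pushout square**: for any algebra structures on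
`Γ(W)`, `W = pr₁⁻¹U ∩ pr₂⁻¹V`, over `Γ(U)`, `Γ(V)` and `K` whose structure maps are `pr₁♯`, `pr₂♯` (and
compatible with `K`), `Γ(W) = Γ(U) ⊗_K Γ(V)` in the sense of Mathlib's `Algebra.IsPushout`.
[cite: Hartshorne1977, II Thm. 3.3] [cite: GortzWedhorn2020, Prop. 4.20] -/
theorem isPushout_sections_fst_inf_snd
    [Algebra K Γ((Y ⊗ Z).left, (fst Y Z).left ⁻¹ᵁ U ⊓ (snd Y Z).left ⁻¹ᵁ V)]
    [Algebra Γ(Y.left, U) Γ((Y ⊗ Z).left, (fst Y Z).left ⁻¹ᵁ U ⊓ (snd Y Z).left ⁻¹ᵁ V)]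
    [Algebra Γ(Z.left, V) Γ((Y ⊗ Z).left, (fst Y Z).left ⁻¹ᵁ U ⊓ (snd Y Z).left ⁻¹ᵁ V)]
    [IsScalarTower K Γ(Y.left, U) Γ((Y ⊗ Z).left, (fst Y Z).left ⁻¹ᵁ U ⊓ (snd Y Z).left ⁻¹ᵁ V)]
    [IsScalarTower K Γ(Z.left, V) Γ((Y ⊗ Z).left, (fst Y Z).left ⁻¹ᵁ U ⊓ (snd Y Z).left ⁻¹ᵁ V)]
    (hf : algebraMap Γ(Y.left, U) Γ((Y ⊗ Z).left, (fst Y Z).left ⁻¹ᵁ U ⊓ (snd Y Z).left ⁻¹ᵁ V) =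
      ((fst Y Z).left.appLE U _ inf_le_left).hom)
    (hg : algebraMap Γ(Z.left, V) Γ((Y ⊗ Z).left, (fst Y Z).left ⁻¹ᵁ U ⊓ (snd Y Z).left ⁻¹ᵁ V) =
      ((snd Y Z).left.appLE V _ inf_le_right).hom) :
    Algebra.IsPushout K Γ(Y.left, U) Γ(Z.left, V)
      Γ((Y ⊗ Z).left, (fst Y Z).left ⁻¹ᵁ U ⊓ (snd Y Z).left ⁻¹ᵁ V) := by
  obtain ⟨r, hr₁, hr₂⟩ := exists_ringEquiv_sections_fst_inf_snd Y Z hU hV h₁ h₂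
  -- `Γ(V)` acts on `Γ(U) ⊗ Γ(V)` through the right factor (Mathlib's non-instance `rightAlgebra`)
  letI : Algebra Γ(Z.left, V) (Γ(Y.left, U) ⊗[K] Γ(Z.left, V)) := Algebra.TensorProduct.rightAlgebra
  let e : (Γ(Y.left, U) ⊗[K] Γ(Z.left, V)) ≃ₐ[Γ(Y.left, U)]
      Γ((Y ⊗ Z).left, (fst Y Z).left ⁻¹ᵁ U ⊓ (snd Y Z).left ⁻¹ᵁ V) :=
    AlgEquiv.ofRingEquiv (f := r) fun a => by
      rw [Algebra.TensorProduct.algebraMap_apply, Algebra.algebraMap_self, RingHom.id_apply, hr₁, hf]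
  refine Algebra.IsPushout.of_equiv (h := TensorProduct.isPushout) e ?_
  ext b
  change r (algebraMap Γ(Z.left, V) (Γ(Y.left, U) ⊗[K] Γ(Z.left, V)) b) = algebraMap _ _ b
  have hb : algebraMap Γ(Z.left, V) (Γ(Y.left, U) ⊗[K] Γ(Z.left, V)) b = 1 ⊗ₜ b := rfl
  rw [hb, hr₂, hg]

omit [Algebra K Γ(Z.left, V)] in
include h₁ in
/-- **The structure maps are compatible**: `K → Γ(U) → Γ(W)` is `K → Γ(W)` for `W = pr₁⁻¹U ∩ pr₂⁻¹V`
(`pr₁` is a morphism over `Spec K`), i.e. `IsScalarTower K Γ(U) Γ(W)` for any algebra structures with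
the canonical structure maps. [cite: Hartshorne1977, II Thm. 3.3] -/
theorem isScalarTower_sections_fst_inf_snd_left
    [Algebra K Γ((Y ⊗ Z).left, (fst Y Z).left ⁻¹ᵁ U ⊓ (snd Y Z).left ⁻¹ᵁ V)]
    [Algebra Γ(Y.left, U) Γ((Y ⊗ Z).left, (fst Y Z).left ⁻¹ᵁ U ⊓ (snd Y Z).left ⁻¹ᵁ V)]
    (hK : algebraMap K Γ((Y ⊗ Z).left, (fst Y Z).left ⁻¹ᵁ U ⊓ (snd Y Z).left ⁻¹ᵁ V) =
      ((Scheme.ΓSpecIso (.of K)).inv ≫ (Y ⊗ Z).hom.appLE ⊤ _ le_top).hom)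
    (hf : algebraMap Γ(Y.left, U) Γ((Y ⊗ Z).left, (fst Y Z).left ⁻¹ᵁ U ⊓ (snd Y Z).left ⁻¹ᵁ V) =
      ((fst Y Z).left.appLE U _ inf_le_left).hom) :
    IsScalarTower K Γ(Y.left, U) Γ((Y ⊗ Z).left, (fst Y Z).left ⁻¹ᵁ U ⊓ (snd Y Z).left ⁻¹ᵁ V) := by
  refine IsScalarTower.of_algebraMap_eq' ?_
  rw [hK, hf, h₁, ← CommRingCat.hom_comp, Category.assoc, Scheme.Hom.appLE_comp_appLE,
    appLE_congr_hom (Over.w (fst Y Z))]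

omit [Algebra K Γ(Y.left, U)] in
include h₂ in
/-- The same for the second projection: `IsScalarTower K Γ(V) Γ(W)`. [cite: Hartshorne1977, II Thm. 3.3] -/
theorem isScalarTower_sections_fst_inf_snd_right
    [Algebra K Γ((Y ⊗ Z).left, (fst Y Z).left ⁻¹ᵁ U ⊓ (snd Y Z).left ⁻¹ᵁ V)]
    [Algebra Γ(Z.left, V) Γ((Y ⊗ Z).left, (fst Y Z).left ⁻¹ᵁ U ⊓ (snd Y Z).left ⁻¹ᵁ V)]
    (hK : algebraMap K Γ((Y ⊗ Z).left, (fst Y Z).left ⁻¹ᵁ U ⊓ (snd Y Z).left ⁻¹ᵁ V) =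
      ((Scheme.ΓSpecIso (.of K)).inv ≫ (Y ⊗ Z).hom.appLE ⊤ _ le_top).hom)
    (hg : algebraMap Γ(Z.left, V) Γ((Y ⊗ Z).left, (fst Y Z).left ⁻¹ᵁ U ⊓ (snd Y Z).left ⁻¹ᵁ V) =
      ((snd Y Z).left.appLE V _ inf_le_right).hom) :
    IsScalarTower K Γ(Z.left, V) Γ((Y ⊗ Z).left, (fst Y Z).left ⁻¹ᵁ U ⊓ (snd Y Z).left ⁻¹ᵁ V) := by
  refine IsScalarTower.of_algebraMap_eq' ?_
  rw [hK, hg, h₂, ← CommRingCat.hom_comp, Category.assoc, Scheme.Hom.appLE_comp_appLE,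
    appLE_congr_hom (Over.w (snd Y Z))]

end Chart

end Literature.AlgebraicGeometry.Motives

end
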